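import Summits.QuantumFields.BalabanUV.T4Continuum.Support.NE7SupLiftLevelMasses
import Summits.QuantumFields.BalabanUV.T4Continuum.Support.NE7MultiplierTermLevelMasses
import Summits.QuantumFields.BalabanUV.T4Continuum.Support.NE7ConstraintSecondDerivativeRecursion
import Summits.QuantumFields.BalabanUV.T4Continuum.Support.AveragingDeficitMultiLevelBridge
import HarnessLib

/-!
# NE7SupLiftLowerBound — (G′) IN SUP CURRENCY, CLOSED MODULO ONE ESTIMATE: at every small datum `V₀`, every minimiser `U♯`, every level `j` (in row NE7b's all-data frame
# `∃ε₀ ∀ε ∀N ∃δ_V ∀j ∀V₀ ∀U♯`), for EVERY fibre element `X` over `v` whose fine field obeys the Bałaban-scaled SUP bound `‖X̃(b)‖ ≤ σ·L^{−(j+1)}`, the bordered value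
# `B[X] = w·hess U♯ X̃ X̃ − Dm(0)[D²𝒢(0)[X,X]]` obeys, for all `θ, θ′ > 0`,
# **`(1+θ′)(1+θ)·B[X] ≥ w·(Σ_P nhs(curl_{V₀}ṽ(P)) − (1+θ′)·K₁·4N⁴σ² − (1+θ′⁻¹)·16·#pl·ε²·N⁴(24σ)²) − (1+θ′)(1+θ)·C_Λ·ε·8·51²·K_maj·L²·N⁴σ²`**
# (`K₁ = (1+θ)·14·#pl·ε + (1+θ⁻¹)·36eC²ε²`, `C_Λ·ε`, `K_maj` = row NE7b's multiplier constants) — j-UNIFORM; hence, whenever the minimum `D²(minAct∘chart_{V₀})(0)[v,v] = min B` is ATTAINED at a lift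
# with `σ = C·|v|_∞` (a k-uniform ℓ^∞ bound on the linearised minimiser — the ONE remaining estimate, Bałaban's `H_k` regularity), `D²m ≥ w(1 − O(θ+θ′))·Σ_P nhs(curl_{V₀}ṽ) − O(ε)·N⁴|v|²_∞`
# (d = 4, every U(n), L ≥ 2; lineage `b2b-balaban-t4-ne7-p1`, gen 118, file G17; memo ROAD-G118 §5 (S3))

Cell `pub-balaban`, rung (B)+1 sub-cell t4, CRUX PROVER NE7 #1 (OWNER of row NE7), generation 118.  Composition BY NAME of this gen's G15 ✓ `NE7SupLiftFloor.coarse_curl_le_hess_of_sup` (Hessian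
half, no slice) and G16 ✓ `NE7SupLiftLevelMasses.weightedLevelMasses_le_of_sup` with row NE7b's ✓ `NE7MultiplierTermLevelMasses.multiplierTerm_le_levelMasses` (gen 161) and the subtype
bridge ✓ `NE7ConstraintSecondDerivativeRecursion.fderiv_fderiv_levelQ_chart_subtype`.
WHAT ([folklore]; 0 def, 0 sorry; `d = 4`, `n : Type`): **`bordered_ge_of_supLift`** (displayed above) and **`effectiveForm_ge_of_attained_supLift`** (the same read for `D²m(0)[v,v]` under the
attainment equation `B[X] = D²m(0)[v,v]`).
HONEST FRAMING (page 1): composition of landed kernel theorems about OUR minimisers; the sup bound on the attaining lift is a displayed HYPOTHESIS — it is NOT in the tree (the tree's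
`V ↦ U_k(V)` Lipschitz constant is existential) and is the single remaining estimate of this route; nothing of Bałaban's asserted ([Balaban1985Variational] Thm 1 (9)–(10),
[Balaban1985PropagatorsII] context); NOT (G′), NOT NE7 as a spine node; spine 0∕9; finite T⁴ rung (B)+1 — NOT infinite volume, NOT mass gap, NOT BetaPertH, NOT Clay.
-/

set_option autoImplicit false

open scoped BigOperators Matrix Matrix.Norms.L2Operator Topology
open NormedSpace Finset Set Filter Metric

namespace Summit.QuantumFields.BalabanUV.T4Continuum.NE7SupLiftLowerBound

open Literature.MathematicalPhysics.QuantumFieldTheory.Balaban1983to89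
open B7Prop1Explicit B7Prop2Explicit MatrixLog UnitaryModel
open T4AveragingDeficitWall (IsUnitaryCfg IsSkewDir SmallField curl dirSq)
open T4AveragingDeficitWallBoundary (IsPeriodicCfg periodBox)
open AveragingDeficitPeriodicCounting (IsPeriodicDir)
open AveragingDeficitTorusChart (TDir chart chartDir isPeriodicDir_chartDir)
open AveragingDeficitTwoLevelPrep (twoLevelSmall skewSub)
open AveragingDeficitMultiLevelPrep (cavgIter tower levelQ levelQ' LevelSmall natCast_tower_succ)
open AveragingDeficitMultiLevelBridge (cavgIter_eq_avgIter)
open MatrixNorms (nhsNormSq)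
open MinimalActionLevels (perWin stepWt)
open MinimalActionSandwich (IsMinimiser minAct)
open MinimalActionRate (sfClass)
open NE3HessForm (hess)
open NE3TangentCovariantTower (dirIter)
open NE7RadIterUniform (radD levelSmall_of_class_radius)
open NE7StraightTowerCurlEnergy (eC mC eC_nonneg)
open NE7FlatAverageCurlCommutation (isSkewDir_chartDir_id)
open NE3HatInvCurlLetters (curl1C curl1C_nonneg)
open BlockAverageVaryHolo (nbRad)
open BlockAverageVaryDisc (rho0)
open NE3LinearisedAverageSup (curv curvSum)
open NE3EnergyRateWSupOfSlicePoincare (tower_eq_mul_pow)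
open NE7SupLiftFloor (coarse_curl_le_hess_of_sup curvSum_line_of_curv)
open NE7SupLiftLevelMasses (weightedLevelMasses_le_of_sup)
open NE7MultiplierTermLevelMasses (multiplierTerm_le_levelMasses)
open NE7ConstraintSecondDerivativeRecursion (fderiv_fderiv_levelQ_chart_subtype)

noncomputable section

variable {n : Type} [Fintype n] [DecidableEq n]

set_option maxHeartbeats 400000 in
/-- **THE BORDERED VALUE OF A SUP-BOUNDED FIBRE ELEMENT IS BOUNDED BELOW BY THE COARSE MAXWELL ENERGY** (`d = 4`, every `U(n)`, `L ≥ 2`; see the module docstring). [cite: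
Balaban1985Variational, Thm 1 p.279; Balaban1985Averaging, (48) p.25; Balaban1985BackgroundPropagators, (3.10) p.391] -/
theorem bordered_ge_of_supLift [Nonempty n] {L : ℕ} [NeZero L] (hL : 2 ≤ L) :
    ∃ ε₀ : ℝ, 0 < ε₀ ∧ ∀ ε : ℝ, 0 < ε → ε ≤ ε₀ →
      4 * ε * radD 4 L * (((L : ℝ) ^ 2)⁻¹) ^ 2 ≤ 1 → twoLevelSmall 4 L * (2 * ε * ((L : ℝ) ^ 2)⁻¹) ≤ 1 →
      8 * (L : ℝ) * mC 4 L (Fintype.card n) * ε * ((L : ℝ) ^ 2)⁻¹ ≤ 1 → curv 4 L ε ≤ 1 / 4 →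
      ∀ (N : ℕ) [NeZero N], 1 ≤ N → ∃ δV : ℝ, 0 < δV ∧ ∀ j : ℕ,
        ∀ V₀ ∈ {V : Site 4 → Fin 4 → (Matrix n n ℂ)ˣ | IsUnitaryCfg V ∧ IsPeriodicCfg V (N : ℤ) ∧ SmallField V δV},
        ∀ Us : Site 4 → Fin 4 → (Matrix n n ℂ)ˣ, IsMinimiser 4 (sfClass 4 L N ε) L N (j + 1) V₀ Us →
        ∀ θ θ' : ℝ, 0 < θ → 0 < θ' → ∀ σ : ℝ, 0 ≤ σ →
        ∀ X : ↥(skewSub 4 n (L * tower L N j)),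
          (∀ (y : Site 4) (κ : Fin 4), ‖chartDir (ContinuousLinearMap.id ℝ (Matrix n n ℂ)) (L * tower L N j) (X : TDir 4 n (L * tower L N j)) y κ‖ ≤ σ * ((L : ℝ)⁻¹) ^ (j + 1)) →
          ((stepWt 4 L)⁻¹) ^ (j + 1) * (∑ P ∈ perWin 4 N, nhsNormSq (curl V₀
                (chartDir (ContinuousLinearMap.id ℝ (Matrix n n ℂ)) N ((levelQ' L N j Us (X : TDir 4 n (L * tower L N j)) : ↥(skewSub 4 n N)) : TDir 4 n N)) P)
              - (1 + θ') * (((1 + θ) * (14 * (Fintype.card (T4AveragingDeficitWall.Plane 4) : ℝ) * ε) + (1 + θ⁻¹) * (36 * eC 4 L (Fintype.card n) ^ 2 * ε ^ 2)) * (4 * (N : ℝ) ^ 4 * σ ^ 2))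
              - (1 + θ'⁻¹) * (16 * (Fintype.card (T4AveragingDeficitWall.Plane 4) : ℝ) * ε ^ 2 * ((N : ℝ) ^ 4 * (24 * σ) ^ 2)))
            - (1 + θ') * (1 + θ) * ((2 * curl1C 4 L * ε * (4 / rho0 4 L ^ 2 * ((4 : ℕ) * (2 * nbRad 4 L + 1) ^ 4)))
                * (8 * 51 ^ 2 * (Real.exp (((L : ℝ) ^ 4 / L) * (((4 : ℕ) : ℝ) * (16 * (((4 : ℕ) : ℝ) + 1) * (((4 : ℕ) : ℝ) + 4) * (L : ℝ) ^ 2)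
                        * (1250 * ((nbRad 4 L : ℝ) + L) + 8 * ((((4 : ℕ) : ℝ)) * L) + 2 * L)) * (2 / twoLevelSmall 4 L))) * (L : ℝ) ^ 2 * (N : ℝ) ^ 4 * σ ^ 2))
          ≤ (1 + θ') * (1 + θ) * (((stepWt 4 L)⁻¹) ^ (j + 1) * hess Us (chartDir (ContinuousLinearMap.id ℝ (Matrix n n ℂ)) (L * tower L N j) (X : TDir 4 n (L * tower L N j)))
                (chartDir (ContinuousLinearMap.id ℝ (Matrix n n ℂ)) (L * tower L N j) (X : TDir 4 n (L * tower L N j))) (perWin 4 (tower L N (j + 1)))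
              - fderiv ℝ (fun y : ↥(skewSub 4 n N) => minAct 4 (sfClass 4 L N ε) L N (j + 1) (chart (ContinuousLinearMap.id ℝ (Matrix n n ℂ)) N V₀ (y : TDir 4 n N))) 0
                  (fderiv ℝ (fderiv ℝ (fun Φ : ↥(skewSub 4 n (L * tower L N j)) =>
                    levelQ L N j Us (chart (ContinuousLinearMap.id ℝ (Matrix n n ℂ)) (L * tower L N j) Us (Φ : TDir 4 n (L * tower L N j))))) 0 X X)) := by
  have hL1 : 1 ≤ L := by omega
  obtain ⟨ε₁, hε₁, H⟩ := multiplierTerm_le_levelMasses (n := n) hL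
  refine ⟨ε₁, hε₁, fun ε hε hεle hεD hεT hεM hcurv N _ hN => ?_⟩
  obtain ⟨δV, hδV, hall⟩ := H ε hε hεle N hN
  refine ⟨δV, hδV, fun j V₀ hV₀ Us hUs θ θ' hθ hθ' σ hσ X hXs => ?_⟩
  have hε0 : 0 ≤ ε := hε.le
  -- class facts for the minimiser
  obtain ⟨hUu, hUP0, hUx0⟩ := hUs.mem.1
  have hUP : IsPeriodicCfg Us ((tower L N (j + 1) : ℕ) : ℤ) := by rw [tower_eq_mul_pow]; exact hUP0
  have hUx : SmallField Us (ε * (((L : ℝ) ^ 2)⁻¹) ^ (j + 1)) := by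
    have e : ε / ((L : ℝ) ^ (j + 1)) ^ 2 = ε * (((L : ℝ) ^ 2)⁻¹) ^ (j + 1) := by rw [div_eq_mul_inv, pow_right_comm, inv_pow]
    rw [← e]; exact hUx0
  have hUsavg : cavgIter L (j + 1) Us = V₀ := by rw [cavgIter_eq_avgIter]; exact hUs.mem.2
  have hUP'' : IsPeriodicCfg Us ((L : ℤ) * (tower L N j : ℕ)) := by rw [← natCast_tower_succ]; exact hUP
  obtain ⟨hs, -⟩ := levelSmall_of_class_radius (d := 4) hL hε0 hεD hεT j
  have hx : 0 ≤ ε * (((L : ℝ) ^ 2)⁻¹) ^ (j + 1) := by positivity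
  have hA := curvSum_line_of_curv hL j hε0 hs hcurv
  set Xt := chartDir (ContinuousLinearMap.id ℝ (Matrix n n ℂ)) (L * tower L N j) (X : TDir 4 n (L * tower L N j)) with hXt
  have hXts : IsSkewDir Xt := isSkewDir_chartDir_id X.2
  have hXtP : IsPeriodicDir Xt ((tower L N (j + 1) : ℕ) : ℤ) := isPeriodicDir_chartDir (ContinuousLinearMap.id ℝ (Matrix n n ℂ)) (L * tower L N j) (X : TDir 4 n (L * tower L N j))
  -- the Hessian half (G15), read at the datum `V₀ = avg^{j+1} U♯`
  have hfloor := coarse_curl_le_hess_of_sup hL hN hε0 hεD hεT hεM hcurv j hUu hUP hUx X.2 hσ hXs hθ hθ'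
  rw [hUsavg] at hfloor
  -- the multiplier half (row NE7b + G16)
  have hmult := hall j V₀ hV₀ Us hUs j Us (ε * (((L : ℝ) ^ 2)⁻¹) ^ (j + 1)) hUu hUP hx hs hUx hUsavg X
  have hsum := weightedLevelMasses_le_of_sup hL j hUu hUP hx hs hUx hA hXts hXtP hσ hXs
    (K := Real.exp (((L : ℝ) ^ 4 / L) * (((4 : ℕ) : ℝ) * (16 * (((4 : ℕ) : ℝ) + 1) * (((4 : ℕ) : ℝ) + 4) * (L : ℝ) ^ 2)
        * (1250 * ((nbRad 4 L : ℝ) + L) + 8 * ((((4 : ℕ) : ℝ)) * L) + 2 * L)) * (2 / twoLevelSmall 4 L))) (Real.exp_nonneg _)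
  have hC0 : 0 ≤ 2 * curl1C 4 L * ε * (4 / rho0 4 L ^ 2 * ((4 : ℕ) * (2 * nbRad 4 L + 1) ^ 4)) := by
    have := curl1C_nonneg 4 L; positivity
  have hm2 := hmult.trans (mul_le_mul_of_nonneg_left hsum hC0)
  -- the subtype bridge
  rw [← fderiv_fderiv_levelQ_chart_subtype (d := 4) hL1 j hUu hUP'' hx hs hUx X X] at hm2
  have hab := (abs_le.mp hm2).2
  -- assemble
  have hw : 0 ≤ ((stepWt 4 L)⁻¹) ^ (j + 1) := pow_nonneg (inv_nonneg.mpr (MinimalActionLevels.stepWt_pos (d := 4) L hL1).le) _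
  have hθθ : 0 ≤ (1 + θ') * (1 + θ) := by positivity
  have h1 := mul_le_mul_of_nonneg_left hfloor hw
  have h2 := mul_le_mul_of_nonneg_left hab hθθ
  nlinarith [h1, h2, hw, hθθ]

/-- **(G′) IN SUP CURRENCY UNDER ATTAINMENT AT A SUP-BOUNDED LIFT**: in the frame of `bordered_ge_of_supLift`, if moreover the bordered value of `X` EQUALS the chart Hessian
`D²(minAct∘chart_{V₀})(0)[v,v]` (`v = levelQ′ X`; attainment — the minimising lift), then the displayed lower bound holds for `(1+θ′)(1+θ)·D²(minAct∘chart_{V₀})(0)[v,v]`. [folklore] -/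
theorem effectiveForm_ge_of_attained_supLift [Nonempty n] {L : ℕ} [NeZero L] (hL : 2 ≤ L) :
    ∃ ε₀ : ℝ, 0 < ε₀ ∧ ∀ ε : ℝ, 0 < ε → ε ≤ ε₀ →
      4 * ε * radD 4 L * (((L : ℝ) ^ 2)⁻¹) ^ 2 ≤ 1 → twoLevelSmall 4 L * (2 * ε * ((L : ℝ) ^ 2)⁻¹) ≤ 1 →
      8 * (L : ℝ) * mC 4 L (Fintype.card n) * ε * ((L : ℝ) ^ 2)⁻¹ ≤ 1 → curv 4 L ε ≤ 1 / 4 →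
      ∀ (N : ℕ) [NeZero N], 1 ≤ N → ∃ δV : ℝ, 0 < δV ∧ ∀ j : ℕ,
        ∀ V₀ ∈ {V : Site 4 → Fin 4 → (Matrix n n ℂ)ˣ | IsUnitaryCfg V ∧ IsPeriodicCfg V (N : ℤ) ∧ SmallField V δV},
        ∀ Us : Site 4 → Fin 4 → (Matrix n n ℂ)ˣ, IsMinimiser 4 (sfClass 4 L N ε) L N (j + 1) V₀ Us →
        ∀ θ θ' : ℝ, 0 < θ → 0 < θ' → ∀ σ : ℝ, 0 ≤ σ → ∀ v : ↥(skewSub 4 n N),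
        ∀ X : ↥(skewSub 4 n (L * tower L N j)), levelQ' L N j Us (X : TDir 4 n (L * tower L N j)) = v →
          (∀ (y : Site 4) (κ : Fin 4), ‖chartDir (ContinuousLinearMap.id ℝ (Matrix n n ℂ)) (L * tower L N j) (X : TDir 4 n (L * tower L N j)) y κ‖ ≤ σ * ((L : ℝ)⁻¹) ^ (j + 1)) →
          ((stepWt 4 L)⁻¹) ^ (j + 1) * hess Us (chartDir (ContinuousLinearMap.id ℝ (Matrix n n ℂ)) (L * tower L N j) (X : TDir 4 n (L * tower L N j)))
                (chartDir (ContinuousLinearMap.id ℝ (Matrix n n ℂ)) (L * tower L N j) (X : TDir 4 n (L * tower L N j))) (perWin 4 (tower L N (j + 1)))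
              - fderiv ℝ (fun y : ↥(skewSub 4 n N) => minAct 4 (sfClass 4 L N ε) L N (j + 1) (chart (ContinuousLinearMap.id ℝ (Matrix n n ℂ)) N V₀ (y : TDir 4 n N))) 0
                  (fderiv ℝ (fderiv ℝ (fun Φ : ↥(skewSub 4 n (L * tower L N j)) =>
                    levelQ L N j Us (chart (ContinuousLinearMap.id ℝ (Matrix n n ℂ)) (L * tower L N j) Us (Φ : TDir 4 n (L * tower L N j))))) 0 X X)
            = fderiv ℝ (fderiv ℝ (fun y : ↥(skewSub 4 n N) => minAct 4 (sfClass 4 L N ε) L N (j + 1) (chart (ContinuousLinearMap.id ℝ (Matrix n n ℂ)) N V₀ (y : TDir 4 n N)))) 0 v v →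
          ((stepWt 4 L)⁻¹) ^ (j + 1) * (∑ P ∈ perWin 4 N, nhsNormSq (curl V₀ (chartDir (ContinuousLinearMap.id ℝ (Matrix n n ℂ)) N (v : TDir 4 n N)) P)
              - (1 + θ') * (((1 + θ) * (14 * (Fintype.card (T4AveragingDeficitWall.Plane 4) : ℝ) * ε) + (1 + θ⁻¹) * (36 * eC 4 L (Fintype.card n) ^ 2 * ε ^ 2)) * (4 * (N : ℝ) ^ 4 * σ ^ 2))
              - (1 + θ'⁻¹) * (16 * (Fintype.card (T4AveragingDeficitWall.Plane 4) : ℝ) * ε ^ 2 * ((N : ℝ) ^ 4 * (24 * σ) ^ 2)))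
            - (1 + θ') * (1 + θ) * ((2 * curl1C 4 L * ε * (4 / rho0 4 L ^ 2 * ((4 : ℕ) * (2 * nbRad 4 L + 1) ^ 4)))
                * (8 * 51 ^ 2 * (Real.exp (((L : ℝ) ^ 4 / L) * (((4 : ℕ) : ℝ) * (16 * (((4 : ℕ) : ℝ) + 1) * (((4 : ℕ) : ℝ) + 4) * (L : ℝ) ^ 2)
                        * (1250 * ((nbRad 4 L : ℝ) + L) + 8 * ((((4 : ℕ) : ℝ)) * L) + 2 * L)) * (2 / twoLevelSmall 4 L))) * (L : ℝ) ^ 2 * (N : ℝ) ^ 4 * σ ^ 2))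
          ≤ (1 + θ') * (1 + θ) * fderiv ℝ (fderiv ℝ (fun y : ↥(skewSub 4 n N) => minAct 4 (sfClass 4 L N ε) L N (j + 1) (chart (ContinuousLinearMap.id ℝ (Matrix n n ℂ)) N V₀ (y : TDir 4 n N)))) 0 v v := by
  obtain ⟨ε₀, hε₀, H⟩ := bordered_ge_of_supLift (n := n) hL
  refine ⟨ε₀, hε₀, fun ε hε hεle hεD hεT hεM hcurv N _ hN => ?_⟩
  obtain ⟨δV, hδV, hall⟩ := H ε hε hεle hεD hεT hεM hcurv N hN
  refine ⟨δV, hδV, fun j V₀ hV₀ Us hUs θ θ' hθ hθ' σ hσ v X hQ hXs hatt => ?_⟩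
  have h := hall j V₀ hV₀ Us hUs θ θ' hθ hθ' σ hσ X hXs
  rw [hatt, hQ] at h
  exact h

end

end Summit.QuantumFields.BalabanUV.T4Continuum.NE7SupLiftLowerBound
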